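import Summits.HodgeConjecture.HodgeConjecture.Theorems.R90S5EvpOfAeRouting             -- ★ (this seat, p861517) `evp_eq_record_of_ae_routesAt`: a.e. ★ `RoutesAt` ⇒ `t(P) = t(⊗ πⁿ(ξ_v))` (E1 `evpAtIntegralLevel`); brings `clFinChoice`, `xiFamilyOfRecord`, V6 frame
import Summits.HodgeConjecture.HodgeConjecture.Theorems.R90S5MemAPacketOfMultOfLaws       -- ★ (p01) `mem_aPacket_of_m_ne_zero_of_laws`: §13.10 ¶3 over the ★ dictionary `TwistedComparisonSpectralSide` (`TwistedComparisonData`, `Laws`)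
import Summits.HodgeConjecture.HodgeConjecture.Theorems.F0P3cStCharTSCharField           -- ★ `qsForm_map_cmConjRingHom_transpose` : `(σΦ₃)ᵀ = Φ₃`
import Summits.HodgeConjecture.HodgeConjecture.Theorems.F0P3cStCharTSShellOrbitalGCan    -- ★ `F0P3cStCharTSShellOrbitalG.isUnit_det_qsForm` : `IsUnit (det Φ₃)`
import HarnessLib

/-!
# R90-TF · S5 «Ch. 13.3» · DEAL #5 (ii): (U-R)@Φ₃ «A-PACKET RIGIDITY ON `U(Φ₃)`» = Thm 13.3.5 proper, FROM THE PRINTED RELATIONS `𝔨.Laws` AND THE PINNED ξ-STRING DATUM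
# (Rogawski 1990, §13.10 p. 230 ¶3 + p. 231 «Theorems 13.3.5 and 13.3.4 are a consequence of …»; Thm 13.3.7 p. 203; §13.3 p. 201; §13.6 p. 209)

Cell `hodgecm-mathlib`, programme R90-TF, section S5 (base `R90-C133`), prover seat R90-C133-p02 (g0), R90-C133-plan (g0) DEAL #5 (2026-09-04T15:43:54Z) item (ii)
«`Theorems/R90S5APacketRigidityQsOfLawsAndPins.lean` — (U-R)@Φ₃ = Thm 13.3.5 proper: `aPacketRigidityQs_of_laws_of_pins … : ∀ … P ξ S₁, (∀ v ∉ S₁, RoutesAt … P ξ v) → MemXiFamily P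
(qsForm-lemmas) μω hμu ξ` (your own (U-R) binder's body READ AT `H := qsForm L`, token for token) — engine: a.e. routing ⇒ e.v.p. string ⇒ (P3) germ ⇒ ★ Thm 13.3.7 (`m ≠ 0` in the germ
⇒ `mem (cls P) Π(ξ)`) ⇒ (P4) ⇒ `MemXiFamily`»; PIN-BYTES PROTOCOL (pins PER INSTANCE, `∃ 𝔨` AFTER the record binders — p01's ★-pending `R90S5QsDictionaryPins` §«WHY PER INSTANCE»:
the ★ dictionary datum is typed AT A FIXED LEVEL `S`, so the datum reading `(P, ξ)` must depend on them).  Crux item `stmt-HodgeConjecture-24833` (h413); `--supports` helper.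
LANE: ONE `def … : Prop` (the sibling HELPER pin predicate `QsPinnedXiStringDatum` for the STRING instance `(L; μ, ξ; P)`, next to its only consumer — S5 RULING 15:53:03Z (b)
«=»: single-author pins protocol relaxed to two sibling predicates, their union being the dealer's D ED. 3 pen) + theorems; no instance, no notation, no `sorry`.
HONEST LABEL: HC_CM is proved only modulo the 7 printed citations (2 remaining named inputs: hLiu418 = stmt-HodgeConjecture-24832, h413 = stmt-HodgeConjecture-24833) until rung 0
closes; REL ≠ ★ ≠ BUILT — this file proves print's §13.10 ¶3 DEDUCTION of Thm 13.3.5 on `U(Φ₃)` FROM the printed relations (`𝔨.Laws`, class P of the ★ dictionary) and NAMED PINS;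
the pins' ∀-closure `hPins` is the explicit debt (junction J-S5→S10, the ξ-line of 13.7 (3) — S10's construction socket + E-S4).

## THE PINS OF THE STRING INSTANCE `(L; μ, ξ; P)` — `QsPinnedXiStringDatum L μω hμu ξ μA P` (keys-free, place-free)
carriers `TGt TG TH` as PARAMETERS (LEAD #16 (A2), S5 RULING 15:53:03Z (E1)); `∃ (𝔨 : TwistedComparisonData TGt TG TH), 𝔨.Laws ∧ ∃ (cls : 𝔨.𝔊.Rep) (ξH : 𝔨.𝔊.PacketH),` (P1) `𝔨.𝔊.m cls ≠ 0` — «`P` read in the dictionary; `P` occurs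
discretely» [§13.3 p. 201]; (P2) `𝔨.IsOneDimH ξH ∧ ¬ 𝔨.𝔊.IsTheta ξH` — «`ξ` read in `Π(H)`, one-dimensional, not `ρ(θ)`» [§13.3 p. 202; Lemma 13.6.3 (c)]; **(P3-evp)** «if `P` has the
eigenvalue package of `⊗_v πⁿ(ξ_v)` off some finite `S₀` (E1 ★ `evpAtIntegralLevel` on the chosen classes ★ `clFinChoice P` vs the ξ-family of record ★ `xiFamilyOfRecord ξ`) then `cls` lies in
the germ of `t(I_{ξ̃′})`: `𝔨.germRep cls = 𝔨.germI ξH`» — the e.v.p.-form of p01's (P3) (whose antecedent `MemXiFamily` is what (U-R) must CONCLUDE, hence unusable here); its antecedent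
is VERBATIM the conclusion (ii) of ★ `evp_eq_record_of_ae_routesAt` read at `H := qsForm L` [§13.6 p. 209–210 (`t(π)`, `ψ_G` injective on e.v.p.'s); Lemma 13.6.3; Prop 13.2.2 (d)];
**(P4-all)** «membership of `cls` in the A-packet `Π(ξH)` READ AT EVERY FINITE PLACE as ξ-envelope membership: `∀ Pk, IsAPacket Pk → liftsTo ξH Pk → mem cls Pk → MemXiFamily P … ξ`» —
«the set of `π = ⊗π_v` such that `π_v ∈ Π_v` for all `v`» [§13.3 p. 201] with `Π(ξ)_v = Π(ξ_v) = {πⁿ(ξ_v), πˢ(ξ_v)}` [§13.1 p. 199] ⊆ the ★ D6 envelope (E-S4 ∕ S1 local packets of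
record).  NOT a pin: `𝔨.Laws` — the content (Thm 10.3.1 (a), Props 13.5.1∕13.6.1∕13.6.2, §13.7 separation, 13.7 (3) coefficient laws, Thm 13.2.1∕Prop 13.2.2 lifts, Prop 13.8.1).

## THE PROOF (print, §13.10 p. 230 ¶3 read for the ξ-line; p. 231)
★ `evp_eq_record_of_ae_routesAt` (a.e. routing ⇒ the eigenvalue string off a finite `S₀`) ⇒ (P3-evp) `germRep cls = germI ξH` ⇒ ★ `mem_aPacket_of_m_ne_zero_of_laws` (⟸ ★ `aPacketMult_of_laws`
= Thm 13.3.7 for `Π(ξ)`: in the germ of `t(I_{ξ̃′})`, `m(cls) ≠ 0 ⇒ cls ∈ Π(ξ)`) with (P1)(P2) ⇒ `mem cls Π(ξH)` ⇒ (P4-all) ⇒ `MemXiFamily P … ξ`.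
* §1 `QsPinnedXiStringDatum` (def) + `qsPinnedXiStringDatum_iff` (`Iff.rfl`).
* §2 `aPacketRigidityQs_of_pinnedXiStringDatum` — ONE instance: pins at `(L; μ, ξ; P)` + a.e. ★ `RoutesAt` off `S₁` (any V6 data `μZ`, `keys`) ⇒ `MemXiFamily P … ξ`.
* §3 HEAD `aPacketRigidityQs_of_laws_of_pins` — the ∀-closure at fixed carriers: `(hPins : ∀ L μω hμu, hμω → ∀ ξ μA P, QsPinnedXiStringDatum TGt TG TH L μω hμu ξ μA P) → ‹(U-R)@Φ₃›`, the conclusion being the `hRigid`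
  binder of ★ `xiMembershipOfArchJ_of_string_of_aPacketRigidity` (p861428) READ AT `H := qsForm L` token for token (`hH hHd` kept as binders; proof-irrelevant against the ★ `qsForm` lemmas).

References: [Rogawski1990] J. Rogawski, *Automorphic Representations of Unitary Groups in Three Variables*, Ann. of Math. Stud. 123 (1990): §13.10 pp. 230–231; Thm 13.3.5, 13.3.6 (c)
p. 202, Thm 13.3.7 p. 203; §13.3 p. 201; §13.1 p. 199, Prop 13.1.3 (d); §13.6 pp. 209–211 (Lemma 13.6.3); Prop 13.2.2 (d) p. 201; §13.8 Prop 13.8.1 p. 213.  [Marshall2014] S. Marshall,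
*Endoscopy and cohomology growth on U(3)*, Compositio Math. 150 (2014), §3.4.  [CartierCorvallis1979] P. Cartier, PSPM 33.1 (1979), §IV.1 Cor. 4.1.
-/

set_option autoImplicit false
-- the mandated namespace repeats the single-problem summit's segment (`HodgeConjecture.HodgeConjecture`)
set_option linter.dupNamespace false

noncomputable section

open NumberField IsDedekindDomain MeasureTheory Filter
open Literature.NumberTheory.Rogawski1990 Literature.NumberTheory.GaloisRepresentations
open Literature.NumberTheory.Automorphic Literature.NumberTheory.Automorphic.UnitaryGroup
open scoped Matrix Classical ComplexOrder

namespace Summit.HodgeConjecture.HodgeConjecture.R90.S5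

open Summit.HodgeConjecture.HodgeConjecture.Cruxes.H413
open Summit.HodgeConjecture.HodgeConjecture.Cruxes.H413.F0P3InnerFormClassificationV6
open Summit.HodgeConjecture.HodgeConjecture.Cruxes.H413.F0P3ClassTokenChoice (clFinChoice)
open Summit.HodgeConjecture.HodgeConjecture.Cruxes.H413.F0P3CohClassRoutingCot (RoutesAt)
open Summit.HodgeConjecture.HodgeConjecture.Cruxes.H413.F0P3XiLocalFamilyOfRecord (xiFamilyOfRecord)
open Summit.HodgeConjecture.HodgeConjecture.Cruxes.H413.K2E1EvpOfAutomorphicClass (evpAtIntegralLevel)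

/-! ## §1 The pins of the string instance `(L; μ, ξ; P)` (sibling of p01's `QsPinnedXiDatumAt`; keys-free, place-free) -/

/-- **`QsPinnedXiStringDatum L μω hμu ξ μA P` — THE PINNED ξ-STRING DATUM EXISTS at the instance `(L; μ, ξ; P)` of the quasi-split `U(Φ₃)`** (junction J-S5→S10, per instance,
sibling of `QsPinnedXiDatumAt`): on the test-function carriers `TGt, TG, TH` there is a ★ twisted-comparison datum `𝔨` (Rogawski §13.5–13.10 as a typed dictionary) satisfying the printed relations `𝔨.Laws`,
with READINGS `cls ∈ 𝔨.𝔊.Rep` of `P` and `ξH ∈ 𝔨.𝔊.PacketH` of `ξ` such that: (P1) `m(cls) ≠ 0`; (P2) `ξH` is one-dimensional and not `ρ(θ)`; (P3-evp) if the chosen classes of `P`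
(★ `clFinChoice`) and the ξ-family of record (★ `xiFamilyOfRecord ξ`, members `πⁿ(ξ_v)`) have the same E1 eigenvalue package at the integral levels off some finite `S₀` («`t(P) = t(⊗_v πⁿ(ξ_v))`»),
then `ψ_G(t(P)) = t(I_{ξ̃′})` (`germRep cls = germI ξH`); (P4-all) membership of `cls` in the A-packet `Π(ξH)` READ AT EVERY FINITE PLACE: `P` lies in the ξ-envelope ★ `MemXiFamily`
(«`π_v ∈ Π(ξ_v)` for all `v`»).  The carrier types `TGt TG TH` are explicit PARAMETERS (LEAD #16 (A2): no `∃` over types — the junction instantiates them at the carriers of record); the `∃` ranges over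
the datum `𝔨` and the readings only.  Its ∀-closure over `(L, μ, hμω, ξ, μA, P)` at fixed carriers is the hypothesis of `aPacketRigidityQs_of_laws_of_pins` (§3).
HELPER PREDICATE, NOT the J-S5→S10 junction socket: its (P4-all) conjunct carries the membership content unless `𝔨` is PINNED to the functionals∕classes of record
(LEAD #16 (A2)); the junction socket is typed by the S5 dealer in D ED. 3 over S10's pinned zero-slice datum (S10 FILE D ED. 2, LEAD #16 (A3)) and will imply this predicate.
(print: Rogawski1990, §13.10 pp. 230–231; Thm 13.3.5 p. 202, Thm 13.3.7 p. 203; §13.3 p. 201; §13.6 pp. 209–210, Lemma 13.6.3; Prop 13.2.2 (d); §13.1 p. 199) -/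
def QsPinnedXiStringDatum (TGt TG TH : Type) (L : Type) [Field L] [NumberField L] [IsCMField L]
    (μω : HeckeCharacter L) (hμu : μω.IsUnitary) (ξ : OneDimAutRepH L)
    (μA : Measure (adelicGroupData (↥(maximalRealSubfield L)) L (IsCMField.complexConj L) 3 (qsForm L)).automorphicQuotient)
    [(adelicGroupData (↥(maximalRealSubfield L)) L (IsCMField.complexConj L) 3 (qsForm L)).IsAutomorphicMeasure μA]
    (P : DiscreteAutomorphicRep (adelicGroupData (↥(maximalRealSubfield L)) L (IsCMField.complexConj L) 3 (qsForm L)) μA) : Prop :=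
  ∃ (𝔨 : TwistedComparisonData TGt TG TH), 𝔨.Laws ∧
    ∃ (cls : 𝔨.𝔊.Rep) (ξH : 𝔨.𝔊.PacketH),
      𝔨.𝔊.m cls ≠ 0 ∧ 𝔨.IsOneDimH ξH ∧ ¬ 𝔨.𝔊.IsTheta ξH ∧
      ((∃ S₀ : Finset (HeightOneSpectrum (𝓞 ↥(maximalRealSubfield L))),
          ∀ (S : Set (HeightOneSpectrum (𝓞 ↥(maximalRealSubfield L)))), (↑S₀ : Set _) ⊆ S →
            ∀ (hP : ∀ v, v ∉ S → (clFinChoice P v).IsSpherical (cmLocalIntegralLevel L 3 (qsForm L) v))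
              (hξ : ∀ v, v ∉ S → (xiFamilyOfRecord L (qsForm L) (F0P3cStCharTSCharField.qsForm_map_cmConjRingHom_transpose L)
                (F0P3cStCharTSShellOrbitalG.isUnit_det_qsForm L) μω hμu ξ v).πn.IsSpherical (cmLocalIntegralLevel L 3 (qsForm L) v)),
              evpAtIntegralLevel L 3 (qsForm L) (fun v => clFinChoice P v) S hP =
                evpAtIntegralLevel L 3 (qsForm L) (fun v => (xiFamilyOfRecord L (qsForm L) (F0P3cStCharTSCharField.qsForm_map_cmConjRingHom_transpose L)
                  (F0P3cStCharTSShellOrbitalG.isUnit_det_qsForm L) μω hμu ξ v).πn) S hξ) →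
        𝔨.germRep cls = 𝔨.germI ξH) ∧
      (∀ Pk : 𝔨.𝔊.Packet, 𝔨.𝔊.IsAPacket Pk → 𝔨.𝔊.liftsTo ξH Pk → 𝔨.𝔊.mem cls Pk →
        MemXiFamily P (F0P3cStCharTSCharField.qsForm_map_cmConjRingHom_transpose L) (F0P3cStCharTSShellOrbitalG.isUnit_det_qsForm L) μω hμu ξ)

/-- Unfolding of `QsPinnedXiStringDatum`, token for token. [cite: Rogawski1990, §13.10 pp. 230–231] -/
theorem qsPinnedXiStringDatum_iff (TGt TG TH : Type) (L : Type) [Field L] [NumberField L] [IsCMField L]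
    (μω : HeckeCharacter L) (hμu : μω.IsUnitary) (ξ : OneDimAutRepH L)
    (μA : Measure (adelicGroupData (↥(maximalRealSubfield L)) L (IsCMField.complexConj L) 3 (qsForm L)).automorphicQuotient)
    [(adelicGroupData (↥(maximalRealSubfield L)) L (IsCMField.complexConj L) 3 (qsForm L)).IsAutomorphicMeasure μA]
    (P : DiscreteAutomorphicRep (adelicGroupData (↥(maximalRealSubfield L)) L (IsCMField.complexConj L) 3 (qsForm L)) μA) :
    QsPinnedXiStringDatum TGt TG TH L μω hμu ξ μA P ↔
      ∃ (𝔨 : TwistedComparisonData TGt TG TH), 𝔨.Laws ∧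
        ∃ (cls : 𝔨.𝔊.Rep) (ξH : 𝔨.𝔊.PacketH),
          𝔨.𝔊.m cls ≠ 0 ∧ 𝔨.IsOneDimH ξH ∧ ¬ 𝔨.𝔊.IsTheta ξH ∧
          ((∃ S₀ : Finset (HeightOneSpectrum (𝓞 ↥(maximalRealSubfield L))),
              ∀ (S : Set (HeightOneSpectrum (𝓞 ↥(maximalRealSubfield L)))), (↑S₀ : Set _) ⊆ S →
                ∀ (hP : ∀ v, v ∉ S → (clFinChoice P v).IsSpherical (cmLocalIntegralLevel L 3 (qsForm L) v))
                  (hξ : ∀ v, v ∉ S → (xiFamilyOfRecord L (qsForm L) (F0P3cStCharTSCharField.qsForm_map_cmConjRingHom_transpose L)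
                    (F0P3cStCharTSShellOrbitalG.isUnit_det_qsForm L) μω hμu ξ v).πn.IsSpherical (cmLocalIntegralLevel L 3 (qsForm L) v)),
                  evpAtIntegralLevel L 3 (qsForm L) (fun v => clFinChoice P v) S hP =
                    evpAtIntegralLevel L 3 (qsForm L) (fun v => (xiFamilyOfRecord L (qsForm L) (F0P3cStCharTSCharField.qsForm_map_cmConjRingHom_transpose L)
                      (F0P3cStCharTSShellOrbitalG.isUnit_det_qsForm L) μω hμu ξ v).πn) S hξ) →
            𝔨.germRep cls = 𝔨.germI ξH) ∧
          (∀ Pk : 𝔨.𝔊.Packet, 𝔨.𝔊.IsAPacket Pk → 𝔨.𝔊.liftsTo ξH Pk → 𝔨.𝔊.mem cls Pk →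
            MemXiFamily P (F0P3cStCharTSCharField.qsForm_map_cmConjRingHom_transpose L) (F0P3cStCharTSShellOrbitalG.isUnit_det_qsForm L) μω hμu ξ) :=
  Iff.rfl

/-! ## §2 One instance: pins + a.e. routing ⇒ envelope membership -/

/-- **(U-R)@Φ₃ AT ONE INSTANCE `(L; μ, ξ; P)`.**  If the pinned ξ-string datum exists at `(L; μ, ξ; P)` (`QsPinnedXiStringDatum`) and the discrete `P` of `U(Φ₃)` is ROUTED by `ξ` off
a finite `S₁` (★ `RoutesAt`, for ANY V6 data `μZ`, `keys` — Haar measures on the `U(Φ₃)(L⁺_v) ⧸ Z` and Keys' labelled pairs), then `P` lies in the ξ-envelope ★ `MemXiFamily P … ξ`.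
Print, §13.10 ¶3 for the ξ-line: routing ⇒ `t(P) = t(⊗ πⁿ(ξ_v))` (★ `evp_eq_record_of_ae_routesAt`) ⇒ `ψ_G(t(P)) = t(I_{ξ̃′})` (P3-evp) ⇒ `P ∈ Π(ξ)` (Thm 13.3.7 in the germ: ★
`mem_aPacket_of_m_ne_zero_of_laws` with (P1)(P2)) ⇒ `P_v ∈ Π(ξ_v)` for all `v` (P4-all).
[cite: Rogawski1990, §13.10 pp. 230–231; Thm 13.3.5 p. 202, Thm 13.3.7 p. 203; §13.3 p. 201; §13.6 pp. 209–210] [cite: Marshall2014, §3.4] -/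
theorem aPacketRigidityQs_of_pinnedXiStringDatum {TGt TG TH : Type} (L : Type) [Field L] [NumberField L] [IsCMField L]
    (μω : HeckeCharacter L) (hμu : μω.IsUnitary)
    [∀ v : HeightOneSpectrum (𝓞 ↥(maximalRealSubfield L)), MeasurableSpace (Gqs L v ⧸ Subgroup.center (Gqs L v))]
    [∀ v : HeightOneSpectrum (𝓞 ↥(maximalRealSubfield L)), BorelSpace (Gqs L v ⧸ Subgroup.center (Gqs L v))]
    (μZ : ∀ v : HeightOneSpectrum (𝓞 ↥(maximalRealSubfield L)), Measure (Gqs L v ⧸ Subgroup.center (Gqs L v)))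
    [∀ v : HeightOneSpectrum (𝓞 ↥(maximalRealSubfield L)), (μZ v).IsHaarMeasure]
    (keys : ∀ (ξ : OneDimAutRepH L) (v : HeightOneSpectrum (𝓞 ↥(maximalRealSubfield L))),
      (∀ w : PlacesOver L v, IsCMField.complexConj L • w.1 = w.1) →
        {p : IrrClass (Gqs L v) × IrrClass (Gqs L v) //
          KeysCaseTwoLabels L v (μω.semilocalComponent L v) (torusLocalComponent L (IsCMField.complexConj L) v ξ.η)
            (torusLocalComponent L (IsCMField.complexConj L) v ξ.ψ) p.1 p.2 ∧
          p.1.IsSquareIntegrable (μZ v) ∧ ¬ p.2.IsSquareIntegrable (μZ v)})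
    (ξ : OneDimAutRepH L)
    (μA : Measure (adelicGroupData (↥(maximalRealSubfield L)) L (IsCMField.complexConj L) 3 (qsForm L)).automorphicQuotient)
    [(adelicGroupData (↥(maximalRealSubfield L)) L (IsCMField.complexConj L) 3 (qsForm L)).IsAutomorphicMeasure μA]
    (P : DiscreteAutomorphicRep (adelicGroupData (↥(maximalRealSubfield L)) L (IsCMField.complexConj L) 3 (qsForm L)) μA)
    (hPins : QsPinnedXiStringDatum TGt TG TH L μω hμu ξ μA P)
    (S₁ : Finset (HeightOneSpectrum (𝓞 ↥(maximalRealSubfield L))))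
    (hroute : ∀ v : HeightOneSpectrum (𝓞 ↥(maximalRealSubfield L)), v ∉ S₁ →
      RoutesAt L (qsForm L) (F0P3cStCharTSCharField.qsForm_map_cmConjRingHom_transpose L) (F0P3cStCharTSShellOrbitalG.isUnit_det_qsForm L)
        μω hμu μZ keys μA P ξ v) :
    MemXiFamily P (F0P3cStCharTSCharField.qsForm_map_cmConjRingHom_transpose L) (F0P3cStCharTSShellOrbitalG.isUnit_det_qsForm L) μω hμu ξ := by
  obtain ⟨𝔨, hlaws, cls, ξH, hm, h1, hnt, hgerm, hmemA⟩ := hPins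
  -- a.e. routing ⇒ the eigenvalue string `t(P) = t(⊗ πⁿ(ξ_v))` off a finite `S₀` (★ `evp_eq_record_of_ae_routesAt`, E1 currency)
  obtain ⟨S₀, -, hevp⟩ := evp_eq_record_of_ae_routesAt L (qsForm L) (F0P3cStCharTSCharField.qsForm_map_cmConjRingHom_transpose L)
    (F0P3cStCharTSShellOrbitalG.isUnit_det_qsForm L) μω hμu μZ keys μA P ξ S₁ hroute
  -- (P3-evp): `cls` lies in the germ of `t(I_{ξ̃′})`
  have hg : 𝔨.germRep cls = 𝔨.germI ξH := hgerm ⟨S₀, hevp⟩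
  -- Thm 13.3.7 in the germ (★): `m(cls) ≠ 0 ⇒ cls ∈ Π(ξH)`; then (P4-all)
  obtain ⟨Pk, hA, hL, hmem⟩ := mem_aPacket_of_m_ne_zero_of_laws 𝔨 hlaws ξH h1 hnt
  exact hmemA Pk hA hL (hmem cls hg hm)

/-! ## §3 HEAD: the ∀-closure — (U-R)@Φ₃ from the pins' closure -/

/-- **DEAL #5 (ii) HEAD — `aPacketRigidityQs_of_laws_of_pins`: (U-R)@Φ₃ «A-PACKET RIGIDITY ON `U(Φ₃)`» (Thm 13.3.5 proper) FROM THE PINS' ∀-CLOSURE.**  Hypothesis `hPins`: at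
every instance `(L; μ` with `μ|𝕀_{L⁺} = ω_{L/L⁺}`; `ξ; P)` the pinned ξ-string datum exists on the FIXED carriers `TGt TG TH` (`QsPinnedXiStringDatum`; a lawful ★
twisted-comparison datum reading `P` and `ξ` — implied by the J-S5→S10 junction socket of D ED. 3 over S10's pinned zero-slice datum).  Conclusion: the `hRigid` binder of ★ `xiMembershipOfArchJ_of_string_of_aPacketRigidity` (p861428) READ AT `H := qsForm L`, token for token — for every V6 frame
(`hH hHd μω hμu hμω`, Borel σ-algebras, Haar `μZ`, Keys data, `μ`), every discrete `P`, `ξ` and finite `S₁`: `(∀ v ∉ S₁, RoutesAt … P ξ v) → MemXiFamily P hH hHd μω hμu ξ`.  Proof: §2 at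
the instance (`hH`, `hHd` are proof-irrelevant against the ★ `qsForm` lemmas).
[cite: Rogawski1990, §13.10 pp. 230–231; Thm 13.3.5 p. 202, Thm 13.3.7 p. 203; §13.3 p. 201] [cite: Marshall2014, §3.4] -/
theorem aPacketRigidityQs_of_laws_of_pins {TGt TG TH : Type}
    (hPins : ∀ (L : Type) [Field L] [NumberField L] [IsCMField L] (μω : HeckeCharacter L) (hμu : μω.IsUnitary),
      (∀ x : Literature.NumberTheory.GaloisRepresentations.ideleGroup ↥(maximalRealSubfield L),
        μω (AdeleRing.ideleBaseChange (↥(maximalRealSubfield L)) L x) = quadraticHeckeCharCM L x) →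
      ∀ (ξ : OneDimAutRepH L)
        (μA : Measure (adelicGroupData (↥(maximalRealSubfield L)) L (IsCMField.complexConj L) 3 (qsForm L)).automorphicQuotient)
        [(adelicGroupData (↥(maximalRealSubfield L)) L (IsCMField.complexConj L) 3 (qsForm L)).IsAutomorphicMeasure μA]
        (P : DiscreteAutomorphicRep (adelicGroupData (↥(maximalRealSubfield L)) L (IsCMField.complexConj L) 3 (qsForm L)) μA),
        QsPinnedXiStringDatum TGt TG TH L μω hμu ξ μA P) :
    ∀ (L : Type) [Field L] [NumberField L] [IsCMField L]
      (hH : ((qsForm L).map (cmConjRingHom L))ᵀ = qsForm L) (hHd : IsUnit (qsForm L).det) (μω : HeckeCharacter L) (hμu : μω.IsUnitary),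
      (∀ x : Literature.NumberTheory.GaloisRepresentations.ideleGroup ↥(maximalRealSubfield L), μω (AdeleRing.ideleBaseChange (↥(maximalRealSubfield L)) L x) = quadraticHeckeCharCM L x) →
      ∀ [∀ v : HeightOneSpectrum (𝓞 ↥(maximalRealSubfield L)), MeasurableSpace (Gqs L v ⧸ Subgroup.center (Gqs L v))]
        [∀ v : HeightOneSpectrum (𝓞 ↥(maximalRealSubfield L)), BorelSpace (Gqs L v ⧸ Subgroup.center (Gqs L v))]
        (μZ : ∀ v : HeightOneSpectrum (𝓞 ↥(maximalRealSubfield L)), Measure (Gqs L v ⧸ Subgroup.center (Gqs L v)))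
        [∀ v : HeightOneSpectrum (𝓞 ↥(maximalRealSubfield L)), (μZ v).IsHaarMeasure]
        (keys : ∀ (ξ : OneDimAutRepH L) (v : HeightOneSpectrum (𝓞 ↥(maximalRealSubfield L))),
          (∀ w : PlacesOver L v, IsCMField.complexConj L • w.1 = w.1) →
            {p : IrrClass (Gqs L v) × IrrClass (Gqs L v) //
              KeysCaseTwoLabels L v (μω.semilocalComponent L v) (torusLocalComponent L (IsCMField.complexConj L) v ξ.η)
                (torusLocalComponent L (IsCMField.complexConj L) v ξ.ψ) p.1 p.2 ∧
              p.1.IsSquareIntegrable (μZ v) ∧ ¬ p.2.IsSquareIntegrable (μZ v)})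
        (μ : Measure (Gp L (qsForm L)).automorphicQuotient) [(Gp L (qsForm L)).IsAutomorphicMeasure μ]
        (P : DiscreteAutomorphicRep (Gp L (qsForm L)) μ) (ξ : OneDimAutRepH L) (S₁ : Finset (HeightOneSpectrum (𝓞 ↥(maximalRealSubfield L)))),
      (∀ v : HeightOneSpectrum (𝓞 ↥(maximalRealSubfield L)), v ∉ S₁ → RoutesAt L (qsForm L) hH hHd μω hμu μZ keys μ P ξ v) →
      MemXiFamily P hH hHd μω hμu ξ := by
  intro L _ _ _ hH hHd μω hμu hμω _ _ μZ _ keys μ _ P ξ S₁ hroute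
  exact aPacketRigidityQs_of_pinnedXiStringDatum L μω hμu μZ keys ξ μ P (hPins L μω hμu hμω ξ μ P) S₁ hroute

end Summit.HodgeConjecture.HodgeConjecture.R90.S5

end
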